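import Summits.AtomisticToContinuum.BoseEinsteinCondensation.Theses.BECConjugateDomination

/-!
# Triage note (r2, triager 2) on card `budget-sign-residue`, crux stmt-AtomisticToContinuum-11784

Kernel-checked BYPASS certificate.  The card's two stubs `DemotionSign` (Σ₋ : `t₋ ≤ 0` on the window) and
`PromotionResidueFloor` (T₊ : `N·√((n_m+1)·S_m) ≤ C·t₊` on the window), together with its provable
`BudgetIdentity` (`t₊ − t₋ = n₀ − n_m`), give — in the SAME order arithmetic as the card's own
`occupationConjugateLaw_of_budget_sign_floor`, but WITHOUT discarding the factor `n₀/N` in the last step —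
a CONDENSATE-FRACTION FLOOR on the window:

  `√(((n+1)·occFrac + 1) · S_m) ≤ C · condFrac`,  i.e.  `f = n₀/N ≥ √((n_m+1)S_m)/C ≥ √(S_m)/C`.

So the card's stub set proves BEC for the positive minimiser (at any one window mode where `S_m` is
bounded below, e.g. the top of the window via the route's own `PuffFloor`, stmt-11785) two lines BEFORE and
WITHOUT `OccupationConjugateLawWindow`, the Lévy bridge, `UVLevyTail` or the crux `InfraredMinimumUncertainty`:
as a line for THIS crux it is dominated by the direct line it contains (triage rule (iv)).  At Bogoliubov
order `t₊ = n₀(1+S)/2` and `√((n+1)S) = (1+S)/2`, so `PromotionResidueFloor(C) ⟺ f ≥ 1/C` exactly (the card: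
"equality with C = 1/f"): the "minimality-free floor" is the condensate fraction.

All `def`s below are copied VERBATIM from `Cruxes/InfraredMinimumUncertainty/IdeatorSketch_r2_k5.lean`
(namespace `…Sketch5`); only `CondensateFloorWindow` and the two theorems are new.
-/

noncomputable section

open MeasureTheory Filter Set
open scoped ENNReal NNReal BigOperators ComplexConjugate

namespace Summit.AtomisticToContinuum.BoseEinsteinCondensation.Cruxes.InfraredMinimumUncertainty.TriageR2K2

open Literature.MathematicalPhysics.QuantumManyBody.BoseGas

/-- VERBATIM `Sketch5.waveVec`. -/
def waveVec (L : ℝ) (m : Fin 3 → ℤ) : Space :=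
  (2 * Real.pi / L) • latticeVec 1 m

/-- VERBATIM `Sketch5.occFrac` (`n_m / N`). -/
def occFrac (n : ℕ) (L : ℝ) (ψ : Config (n + 1) → ℂ) (m : Fin 3 → ℤ) : ℝ :=
  ∫ Y in cellN n L, ‖∫ x in cell L, starRingEnd ℂ (cellWave L m x) * ψ (Matrix.vecCons x Y)‖ ^ 2 / L ^ 3

/-- VERBATIM `Sketch5.condFrac` (`n₀ / N = f`). -/
def condFrac (n : ℕ) (L : ℝ) (ψ : Config (n + 1) → ℂ) : ℝ :=
  ∫ Y in cellN n L, ‖∫ x in cell L, ψ (Matrix.vecCons x Y)‖ ^ 2 / L ^ 3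

/-- VERBATIM `Sketch5.structureFactor` (the crux's `let S`). -/
def structureFactor (n : ℕ) (L : ℝ) (ψ : Config (n + 1) → ℂ) (m : Fin 3 → ℤ) : ℝ :=
  ((n : ℝ) + 1)⁻¹ * ∫ X in cellN (n + 1) L, ‖∑ j : Fin (n + 1), cellWave L m (X j)‖ ^ 2 * ‖ψ X‖ ^ 2

/-- VERBATIM `Sketch5.densityBar`. -/
def densityBar (n : ℕ) (L : ℝ) (m : Fin 3 → ℤ) (x : Space) (Y : Config n) : ℂ :=
  starRingEnd ℂ (cellWave L m x) + ∑ l : Fin n, starRingEnd ℂ (cellWave L m (Y l))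

/-- VERBATIM `Sketch5.demotionOverlap` (`t₋`). -/
def demotionOverlap (n : ℕ) (L : ℝ) (ψ : Config (n + 1) → ℂ) (m : Fin 3 → ℤ) : ℝ :=
  ((n : ℝ) + 1) / L ^ 3 *
    (∫ x in cell L, ∫ Y in cellN n L,
      (∫ y in cell L, cellWave L m y * starRingEnd ℂ (ψ (Matrix.vecCons y Y))) *
        densityBar n L m x Y * ψ (Matrix.vecCons x Y)).re

/-- VERBATIM `Sketch5.promotionOverlap` (`t₊`). -/
def promotionOverlap (n : ℕ) (L : ℝ) (ψ : Config (n + 1) → ℂ) (m : Fin 3 → ℤ) : ℝ :=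
  ((n : ℝ) + 1) / L ^ 3 *
    (∫ x in cell L, ∫ Y in cellN n L,
      (∫ y in cell L, starRingEnd ℂ (ψ (Matrix.vecCons y Y))) *
        (cellWave L m x * densityBar n L m x Y * ψ (Matrix.vecCons x Y))).re

/-- VERBATIM `Sketch5.BudgetIdentity`. -/
def BudgetIdentity : Prop :=
  ∀ (n : ℕ) (L : ℝ), 0 < L → ∀ Ψ : PeriodicTrialState (n + 1) L, (∀ X, Ψ.ψ X = (‖Ψ.ψ X‖ : ℂ)) →
    ∀ m : Fin 3 → ℤ,
      promotionOverlap n L Ψ.ψ m - demotionOverlap n L Ψ.ψ m =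
          ((n : ℝ) + 1) * condFrac n L Ψ.ψ - ((n : ℝ) + 1) * occFrac n L Ψ.ψ m ∧
      0 ≤ occFrac n L Ψ.ψ m ∧ condFrac n L Ψ.ψ ≤ 1

/-- VERBATIM `Sketch5.Frame` (the crux frame of `InfraredMinimumUncertainty`). -/
def Frame (P : (ℝ → ℝ≥0∞) → ℝ → ∀ (ρ : ℝ) (n : ℕ),
    PeriodicTrialState (n + 1) (sideLength ρ (n + 1)) → Prop) : Prop :=
  ∀ v : ℝ → ℝ≥0∞, IsRepulsiveFiniteRange v → (∀ r, v r ≠ ⊤) →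
    ContDiff ℝ 2 (fun x : Space => (v ‖x‖).toReal) →
    (∃ Cₑ : ℝ, ∀ x : Space,
      ‖iteratedFDeriv ℝ 2 (fun x : Space => (v ‖x‖).toReal) x‖ ≤ Cₑ * Real.sqrt ((v ‖x‖).toReal)) →
    ∃ C : ℝ, 0 ≤ C ∧ ∃ ρ₀ : ℝ, 0 < ρ₀ ∧ ∀ ρ : ℝ, 0 < ρ → ρ < ρ₀ → ∀ᶠ n : ℕ in atTop,
      ∀ Ψ : PeriodicTrialState (n + 1) (sideLength ρ (n + 1)),
        periodicEnergy v Ψ = periodicGroundStateEnergy v (n + 1) (sideLength ρ (n + 1)) →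
        periodicEnergy v Ψ ≠ ⊤ → (∀ X, Ψ.ψ X = (‖Ψ.ψ X‖ : ℂ)) → (∀ X, Ψ.ψ X ≠ 0) → P v C ρ n Ψ

/-- VERBATIM `Sketch5.DemotionSign` (stub Σ₋). -/
def DemotionSign (K₀ : ℝ) : Prop :=
  Frame fun _v _C ρ n Ψ => ∀ m : Fin 3 → ℤ, m ≠ 0 →
    ‖waveVec (sideLength ρ (n + 1)) m‖ ≤ K₀ * Real.sqrt ρ →
      demotionOverlap n (sideLength ρ (n + 1)) Ψ.ψ m ≤ 0

/-- VERBATIM `Sketch5.PromotionResidueFloor` (stub T₊). -/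
def PromotionResidueFloor (K₀ : ℝ) : Prop :=
  Frame fun _v C ρ n Ψ => ∀ m : Fin 3 → ℤ, m ≠ 0 →
    ‖waveVec (sideLength ρ (n + 1)) m‖ ≤ K₀ * Real.sqrt ρ →
      ((n : ℝ) + 1) * Real.sqrt ((((n : ℝ) + 1) * occFrac n (sideLength ρ (n + 1)) Ψ.ψ m + 1) *
          structureFactor n (sideLength ρ (n + 1)) Ψ.ψ m) ≤
        C * promotionOverlap n (sideLength ρ (n + 1)) Ψ.ψ m

/-- NEW (this note). **Condensate-fraction floor on the window**: `√(((n+1)·occFrac + 1)·S_m) ≤ C · condFrac`,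
i.e. `n₀/N ≥ √((n_m + 1) S_m)/C` — BEC for the positive minimiser at any one window mode with `S_m ≥ s₀ > 0`. -/
def CondensateFloorWindow (K₀ : ℝ) : Prop :=
  Frame fun _v C ρ n Ψ => ∀ m : Fin 3 → ℤ, m ≠ 0 →
    ‖waveVec (sideLength ρ (n + 1)) m‖ ≤ K₀ * Real.sqrt ρ →
      Real.sqrt ((((n : ℝ) + 1) * occFrac n (sideLength ρ (n + 1)) Ψ.ψ m + 1) *
          structureFactor n (sideLength ρ (n + 1)) Ψ.ψ m) ≤
        C * condFrac n (sideLength ρ (n + 1)) Ψ.ψ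

/-- Order arithmetic of the bypass: budget `tp − tm = N·f − N·o`, sign `tm ≤ 0`, `0 ≤ o`, floor
`N·r ≤ C·tp`, `0 ≤ C`, `0 < N` give `r ≤ C·f` (the card's `conj_product_le` used `f ≤ 1` here and lost `f`). -/
theorem floor_le_condFrac {N f o tp tm C r : ℝ} (hN : 0 < N) (hb : tp - tm = N * f - N * o)
    (hm : tm ≤ 0) (ho : 0 ≤ o) (hC : 0 ≤ C) (hf : N * r ≤ C * tp) : r ≤ C * f := by
  have htp : tp ≤ N * f := by nlinarith
  have h1 : C * tp ≤ C * (N * f) := mul_le_mul_of_nonneg_left htp hC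
  have h2 : N * r ≤ N * (C * f) := by linarith
  exact le_of_mul_le_mul_left h2 hN

/-- **BYPASS (kernel-checked): budget + demotion sign + promotion floor ⇒ a condensate-fraction floor on
the window**, with the SAME constant `C` as the floor stub.  No occupation law, no Lévy bridge, no UV
tail, no `InfraredMinimumUncertainty`. -/
theorem condensateFloor_of_budget_sign_floor (K₀ : ℝ) (hB : BudgetIdentity)
    (hS : DemotionSign K₀) (hT : PromotionResidueFloor K₀) : CondensateFloorWindow K₀ := by
  intro v hv hfin hC2 hedge
  obtain ⟨C₁, _hC₁, ρ₁, hρ₁, h₁⟩ := hS v hv hfin hC2 hedge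
  obtain ⟨C₂, hC₂, ρ₂, hρ₂, h₂⟩ := hT v hv hfin hC2 hedge
  refine ⟨C₂, hC₂, min ρ₁ ρ₂, lt_min hρ₁ hρ₂, ?_⟩
  intro ρ hρ hρlt
  have hρ1 : ρ < ρ₁ := lt_of_lt_of_le hρlt (min_le_left _ _)
  have hρ2 : ρ < ρ₂ := lt_of_lt_of_le hρlt (min_le_right _ _)
  filter_upwards [h₁ ρ hρ hρ1, h₂ ρ hρ hρ2] with n hn₁ hn₂
  intro Ψ hE hEfin hreal hpos m hm hwin
  have hsign := hn₁ Ψ hE hEfin hreal hpos m hm hwin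
  have hfloor := hn₂ Ψ hE hEfin hreal hpos m hm hwin
  have hL : 0 < sideLength ρ (n + 1) := by
    unfold sideLength
    apply Real.rpow_pos_of_pos
    positivity
  obtain ⟨hbud, hocc, _hcond⟩ := hB n (sideLength ρ (n + 1)) hL Ψ hreal m
  have hN : (0 : ℝ) < (n : ℝ) + 1 := by positivity
  exact floor_le_condFrac hN hbud hsign hocc hC₂ hfloor

end Summit.AtomisticToContinuum.BoseEinsteinCondensation.Cruxes.InfraredMinimumUncertainty.TriageR2K2

end
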